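import Literature.InformationTheory.QuantumCodes.HypergraphProductKernels

/-!
# Hypergraph product: the minimum-distance lower bound (Tillich–Zémor, Thm 9) — proof

We prove `HypergraphProduct.minDist_ge` (Tillich–Zémor 2014, Theorem 9 as printed: "The minimum distance
`D` of the quantum code `Q_ℋ` satisfies `D ≥ min(d₁,d₂,d₁ᵀ,d₂ᵀ)`"; held text arXiv:0903.0566v1 chunk p0008
L1-52) [TillichZemor2014].

Proof (the paper's restriction argument, in the matrix form of Kovalev–Pryadko 2012 §IV-A: "we construct a
quantum code from the matrices `ℋ₁'`, `ℋ₂'` formed only by the columns … that are involved … the reduced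
code has `k = 0`"). Write a cycle `e` of `ℋ = ℋ₁·ℋ₂` that is not a sum of chambers as `(M, N)` with
`H₁ M = N H₂ᵀ` (`HypergraphProductKernels`). If `|e| < min(d₁, d₂)` then the rows of `M` that occur
(`< d₁` of them) index linearly independent columns of `H₁`, and the columns of `N` that occur (`< d₂`)
index independent columns of `H₂`: a dependency would be a nonzero cycle of `ℋᵢ` of weight `< dᵢ`. With
left inverses `L₁ H₁' = 1`, `L₂ H₂' = 1` of the restricted matrices, `G := L₁ N'` satisfies `G H₂'ᵀ = M'`
and `H₁' G = N'` (`exists_chamber_decomposition`), i.e. `e` IS a sum of chambers — contradiction. The bound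
for cocycle-type vectors (`ker H_Z ∖ rowsp H_X`, `≥ min(d₁ᵀ,d₂ᵀ)`) is the same statement for the Poincaré
dual `ℋ₁ᵀ·ℋ₂ᵀ` (TZ Prop. 2, `zMatrix_eq_submatrix_swap`).
-/

namespace Literature.InformationTheory.QuantumCodes

open Matrix Module
open scoped Kronecker

namespace HypergraphProduct

/-! ### Restriction to a set of rows / columns -/

section Restrict

variable {F : Type*} [Field F]
variable {V E W : Type*} [Fintype V] [Fintype E] [Fintype W] [DecidableEq E]

omit [Fintype V] [Fintype E] [Fintype W] in
/-- A matrix whose rows outside the range of an injection `ι` vanish is recovered from its restriction: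
`M = 𝟙_ι · M|_ι` with `𝟙_ι = (1).submatrix id ι` the inclusion matrix. [cite: TillichZemor2014, proof of Thm 9 (arXiv v1 chunk p0008 L20-35: the sub-hypergraph `ℋ₁(𝒵)` of the edges that occur)] -/
private theorem inclusion_mul_restrict {R : Type*} [Fintype R] (ι : R → E) (hι : Function.Injective ι)
    (M : Matrix E W F) (hM : ∀ α, M α ≠ 0 → α ∈ Set.range ι) :
    (1 : Matrix E E F).submatrix id ι * M.submatrix ι id = M := by
  ext α b
  rw [Matrix.mul_apply]
  by_cases hα : α ∈ Set.range ι
  · obtain ⟨ρ, rfl⟩ := hα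
    rw [Finset.sum_eq_single ρ]
    · change (1 : Matrix E E F) (ι ρ) (ι ρ) * M (ι ρ) b = M (ι ρ) b
      rw [Matrix.one_apply_eq, one_mul]
    · intro ρ' _ hne
      have : ι ρ ≠ ι ρ' := fun h => hne (hι h).symm
      simp [this]
    · simp
  · have hzero : M α = 0 := by
      by_contra h
      exact hα (hM α h)
    rw [show M α b = 0 from congrFun hzero b]
    refine Finset.sum_eq_zero fun ρ _ => ?_
    have : α ≠ ι ρ := fun h => hα ⟨ρ, h.symm⟩
    simp [this]

omit [Fintype W] [DecidableEq E] in
/-- A full-column-rank matrix over a field has a left inverse. [cite: TillichZemor2014, proof of Thm 9 (arXiv v1 chunk p0008 L30-40: `dim Z(ℋ₁(𝒵)) = 0`)] -/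
private theorem exists_left_inverse_of_ker_eq_bot {R : Type*} [Fintype R] [DecidableEq R]
    [DecidableEq V] (A : Matrix V R F) (hA : LinearMap.ker A.mulVecLin = ⊥) :
    ∃ L : Matrix R V F, L * A = 1 := by
  obtain ⟨g, hg⟩ := A.mulVecLin.exists_leftInverse_of_injective hA
  refine ⟨LinearMap.toMatrix' g, ?_⟩
  have h := congrArg LinearMap.toMatrix' hg
  rwa [← Matrix.toLin'_apply', LinearMap.toMatrix'_comp, LinearMap.toMatrix'_toLin',
    LinearMap.toMatrix'_id] at h

end Restrict

/-! ### The decomposition into chambers (core of Theorem 9) -/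

section Core

variable {F : Type*} [Field F] [DecidableEq F]
variable {V₁ E₁ V₂ E₂ : Type*}
variable [Fintype V₁] [Fintype E₁] [Fintype V₂] [Fintype E₂]
variable [DecidableEq V₁] [DecidableEq E₁] [DecidableEq V₂] [DecidableEq E₂]

/-- **Core of TZ Theorem 9.** Let `H₁ M = N H₂ᵀ` (a cycle `(M,N)` of `ℋ₁·ℋ₂`, up to the sign irrelevant in
characteristic two). If the columns of `H₁` indexed by the nonzero rows of `M` are linearly independent and
the columns of `H₂` indexed by the nonzero columns of `N` are linearly independent (in the paper: the
sub-hypergraphs `ℋ₁(𝒵)`, `ℋ₂(𝒵)` have no nonzero cycle, so the sub-product has dimension `0` by Cor. 8 and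
every cycle of it is a sum of chambers), then `(M,N)` is a sum of chambers: `M = G H₂ᵀ`, `N = H₁ G` for some
`G`. [cite: TillichZemor2014, proof of Thm 9 (arXiv v1 chunk p0008 L16-45)] -/
theorem exists_chamber_decomposition (H₁ : Matrix V₁ E₁ F) (H₂ : Matrix V₂ E₂ F)
    (M : Matrix E₁ V₂ F) (N : Matrix V₁ E₂ F) (hMN : H₁ * M = N * H₂ᵀ)
    (h₁ : LinearMap.ker (H₁.submatrix id (Subtype.val : {α // M α ≠ 0} → E₁)).mulVecLin = ⊥)
    (h₂ : LinearMap.ker (H₂.submatrix id (Subtype.val : {β // Nᵀ β ≠ 0} → E₂)).mulVecLin = ⊥) :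
    ∃ G : Matrix E₁ E₂ F, M = G * H₂ᵀ ∧ N = H₁ * G := by
  -- restrictions to the rows of `M` / columns of `N` that occur
  set ι₁ : {α // M α ≠ 0} → E₁ := Subtype.val with hι₁
  set ι₂ : {β // Nᵀ β ≠ 0} → E₂ := Subtype.val with hι₂
  set I₁ : Matrix E₁ {α // M α ≠ 0} F := (1 : Matrix E₁ E₁ F).submatrix id ι₁ with hI₁
  set I₂ : Matrix E₂ {β // Nᵀ β ≠ 0} F := (1 : Matrix E₂ E₂ F).submatrix id ι₂ with hI₂
  set H₁' := H₁.submatrix id ι₁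
  set H₂' := H₂.submatrix id ι₂
  set M' := M.submatrix ι₁ id
  set N' := N.submatrix id ι₂
  have hHI₁ : H₁ * I₁ = H₁' := by
    simpa [hI₁] using Matrix.mul_submatrix_one (Equiv.refl E₁) ι₁ H₁
  have hHI₂ : H₂ * I₂ = H₂' := by
    simpa [hI₂] using Matrix.mul_submatrix_one (Equiv.refl E₂) ι₂ H₂
  have hM : I₁ * M' = M :=
    inclusion_mul_restrict ι₁ Subtype.val_injective M fun α hα => ⟨⟨α, hα⟩, rfl⟩
  have hN : N' * I₂ᵀ = N := by
    have h := inclusion_mul_restrict (F := F) ι₂ Subtype.val_injective Nᵀ fun β hβ => ⟨⟨β, hβ⟩, rfl⟩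
    have h' := congrArg Matrix.transpose h
    simp only [Matrix.transpose_mul, Matrix.transpose_submatrix, Matrix.transpose_transpose] at h'
    exact h'
  -- left inverses of the restricted parity-check matrices
  obtain ⟨L₁, hL₁⟩ := exists_left_inverse_of_ker_eq_bot H₁' h₁
  obtain ⟨L₂, hL₂⟩ := exists_left_inverse_of_ker_eq_bot H₂' h₂
  -- the restricted relation `H₁' M' = N' H₂'ᵀ`
  have hMN' : H₁' * M' = N' * H₂'ᵀ := by
    rw [← hHI₁, ← hHI₂, Matrix.transpose_mul, Matrix.mul_assoc, hM, ← Matrix.mul_assoc N', hN, hMN]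
  -- `N' = H₁' M' L₂ᵀ`
  have hN' : N' = H₁' * M' * L₂ᵀ := by
    rw [hMN', Matrix.mul_assoc, ← Matrix.transpose_mul, hL₂, Matrix.transpose_one, Matrix.mul_one]
  refine ⟨I₁ * (L₁ * N') * I₂ᵀ, ?_, ?_⟩
  · -- `G H₂ᵀ = I₁ L₁ N' I₂ᵀ H₂ᵀ = I₁ L₁ N' H₂'ᵀ = I₁ L₁ H₁' M' = I₁ M' = M`
    calc M = I₁ * M' := hM.symm
      _ = I₁ * (L₁ * H₁' * M') := by rw [hL₁, Matrix.one_mul]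
      _ = I₁ * (L₁ * (N' * H₂'ᵀ)) := by rw [Matrix.mul_assoc, hMN']
      _ = I₁ * (L₁ * N') * I₂ᵀ * H₂ᵀ := by
        rw [← hHI₂, Matrix.transpose_mul]
        simp only [Matrix.mul_assoc]
  · -- `H₁ G = H₁' L₁ N' I₂ᵀ = H₁' L₁ H₁' M' L₂ᵀ I₂ᵀ = H₁' M' L₂ᵀ I₂ᵀ = N' I₂ᵀ = N`
    calc N = N' * I₂ᵀ := hN.symm
      _ = H₁' * M' * L₂ᵀ * I₂ᵀ := by rw [← hN']
      _ = H₁' * (L₁ * H₁') * M' * L₂ᵀ * I₂ᵀ := by rw [hL₁, Matrix.mul_one]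
      _ = H₁' * (L₁ * N') * I₂ᵀ := by rw [hN']; simp only [Matrix.mul_assoc]
      _ = H₁ * (I₁ * (L₁ * N') * I₂ᵀ) := by rw [← hHI₁]; simp only [Matrix.mul_assoc]

end Core

/-! ### Light vectors index independent columns -/

section Light

variable {V E : Type*} [Fintype V] [Fintype E] [DecidableEq V] [DecidableEq E]

omit [Fintype V] [DecidableEq V] in
/-- If `|S| < d(ker H)` then the columns of `H` indexed by `S` are linearly independent: a dependency,
extended by zero, would be a nonzero word of `ker H` of weight `≤ |S| < d` ("cycles of `ℋ₁` have at least
`d₁` edges and the number of edges of `ℋ₁(𝒵)` is at most `|𝒵| < d₁`; therefore the only cycle in `ℋ₁(𝒵)` is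
the empty cycle"). [cite: TillichZemor2014, proof of Thm 9 (arXiv v1 chunk p0008 L30-37)] -/
theorem ker_submatrix_eq_bot_of_card_lt {R : Type*} [Fintype R] [DecidableEq R]
    (H : Matrix V E (ZMod 2)) (ι : R → E) (hι : Function.Injective ι)
    (hR : (Fintype.card R : ℕ∞) < Coding.minDist (pcCode H)) :
    LinearMap.ker (H.submatrix id ι).mulVecLin = ⊥ := by
  rw [LinearMap.ker_eq_bot']
  intro x hx
  rw [Matrix.mulVecLin_apply] at hx
  -- extend `x` by zero along `ι`
  set I : Matrix E R (ZMod 2) := (1 : Matrix E E (ZMod 2)).submatrix id ι with hI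
  have hHI : H * I = H.submatrix id ι := by
    simpa [hI] using Matrix.mul_submatrix_one (Equiv.refl E) ι H
  have hIx : ∀ ρ, (I *ᵥ x) (ι ρ) = x ρ := fun ρ => by
    rw [Matrix.mulVec, dotProduct, Finset.sum_eq_single ρ]
    · change (1 : Matrix E E (ZMod 2)) (ι ρ) (ι ρ) * x ρ = x ρ
      rw [Matrix.one_apply_eq, one_mul]
    · intro ρ' _ hne
      have : ι ρ ≠ ι ρ' := fun h => hne (hι h).symm
      simp [hI, this]
    · simp
  have hIx0 : ∀ α, α ∉ Set.range ι → (I *ᵥ x) α = 0 := fun α hα => by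
    rw [Matrix.mulVec, dotProduct]
    refine Finset.sum_eq_zero fun ρ _ => ?_
    have : α ≠ ι ρ := fun h => hα ⟨ρ, h.symm⟩
    simp [hI, this]
  have hmem : I *ᵥ x ∈ pcCode H := by
    rw [mem_pcCode_iff, Matrix.mulVec_mulVec, hHI, hx]
  -- its weight is at most `|R|`
  have hwt : hammingNorm (I *ᵥ x) ≤ Fintype.card R := by
    unfold hammingNorm
    calc (Finset.univ.filter fun α => (I *ᵥ x) α ≠ 0).card
        ≤ (Finset.univ.image ι).card := by
          refine Finset.card_le_card fun α hα => ?_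
          rw [Finset.mem_filter] at hα
          by_contra hni
          exact hα.2 (hIx0 α fun ⟨ρ, hρ⟩ => hni (Finset.mem_image.2 ⟨ρ, Finset.mem_univ _, hρ⟩))
      _ ≤ Fintype.card R := Finset.card_image_le.trans (by simp)
  -- so it must vanish, hence `x = 0`
  have hzero : I *ᵥ x = 0 := by
    by_contra hne
    have h := Coding.minDist_le_hammingNorm hmem hne
    exact (lt_irrefl _) ((hR.trans_le h).trans_le (by exact_mod_cast hwt))
  ext ρ
  rw [← hIx ρ, hzero, Pi.zero_apply, Pi.zero_apply]

end Light

/-! ### Theorem 9 -/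

variable {V₁ E₁ V₂ E₂ : Type*}
variable [Fintype V₁] [Fintype E₁] [Fintype V₂] [Fintype E₂]
variable [DecidableEq V₁] [DecidableEq E₁] [DecidableEq V₂] [DecidableEq E₂]

omit [DecidableEq V₁] [DecidableEq E₁] [DecidableEq V₂] [DecidableEq E₂] in
/-- The number of nonzero rows of the `E_R`-part is at most the weight. [cite: TillichZemor2014, proof of Thm 9 (arXiv v1 chunk p0008 L33-35: "the number of edges of `ℋ₁(𝒵)` is at most `|𝒵|`")] -/
private theorem card_rows_partR_le (e : (E₁ × V₂) ⊕ (V₁ × E₂) → ZMod 2) :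
    Fintype.card {α // partR e α ≠ 0} ≤ hammingNorm e := by
  classical
  have hch : ∀ α : {α // partR e α ≠ 0}, ∃ b, e (Sum.inl (α.1, b)) ≠ 0 := fun ⟨α, hα⟩ => by
    obtain ⟨b, hb⟩ := Function.ne_iff.1 hα
    exact ⟨b, by simpa using hb⟩
  choose f hf using hch
  unfold hammingNorm
  rw [← Finset.card_univ]
  refine Finset.card_le_card_of_injOn (fun α => Sum.inl (α.1, f α)) (fun α _ => by simpa using hf α) ?_
  rintro α - α' - h
  simp only [Sum.inl.injEq, Prod.mk.injEq] at h
  exact Subtype.ext h.1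

omit [DecidableEq V₁] [DecidableEq E₁] [DecidableEq V₂] [DecidableEq E₂] in
/-- The number of nonzero columns of the `E_L`-part is at most the weight. [cite: TillichZemor2014, proof of Thm 9 (arXiv v1 chunk p0008 L33-37)] -/
private theorem card_cols_partL_le (e : (E₁ × V₂) ⊕ (V₁ × E₂) → ZMod 2) :
    Fintype.card {β // (partL e)ᵀ β ≠ 0} ≤ hammingNorm e := by
  classical
  have hch : ∀ β : {β // (partL e)ᵀ β ≠ 0}, ∃ a, e (Sum.inr (a, β.1)) ≠ 0 := fun ⟨β, hβ⟩ => by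
    obtain ⟨a, ha⟩ := Function.ne_iff.1 hβ
    exact ⟨a, by simpa using ha⟩
  choose f hf using hch
  unfold hammingNorm
  rw [← Finset.card_univ]
  refine Finset.card_le_card_of_injOn (fun β => Sum.inr (f β, β.1)) (fun β _ => by simpa using hf β) ?_
  rintro β - β' - h
  simp only [Sum.inr.injEq, Prod.mk.injEq] at h
  exact Subtype.ext h.2

/-- **TZ Theorem 9, cycle half:** a cycle of `ℋ₁·ℋ₂` that is not a sum of chambers has at least
`min(d₁, d₂)` edges. [cite: TillichZemor2014, Thm 9 and its proof (arXiv v1 chunk p0008 L11-45)] -/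
theorem min_le_hammingNorm_of_cycle (H₁ : Matrix V₁ E₁ (ZMod 2)) (H₂ : Matrix V₂ E₂ (ZMod 2))
    {e : (E₁ × V₂) ⊕ (V₁ × E₂) → ZMod 2} (he : e ∈ pcCode (xMatrix H₁ H₂))
    (hne : e ∉ rowSpace (zMatrix H₁ H₂)) :
    min (Coding.minDist (pcCode H₁)) (Coding.minDist (pcCode H₂)) ≤ (hammingNorm e : ℕ∞) := by
  by_contra hlt
  rw [not_le, lt_min_iff] at hlt
  apply hne
  rw [mem_rowSpace_zMatrix_iff]
  have hMN : H₁ * partR e = partL e * H₂ᵀ := by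
    have h := (mem_pcCode_xMatrix_iff H₁ H₂ e).1 he
    rw [add_eq_zero_iff_eq_neg] at h
    rw [h]
    ext a b
    exact ZMod.neg_eq_self_mod_two _
  refine exists_chamber_decomposition H₁ H₂ (partR e) (partL e) hMN ?_ ?_
  · exact ker_submatrix_eq_bot_of_card_lt H₁ _ Subtype.val_injective
      (lt_of_le_of_lt (by exact_mod_cast card_rows_partR_le e) hlt.1)
  · exact ker_submatrix_eq_bot_of_card_lt H₂ _ Subtype.val_injective
      (lt_of_le_of_lt (by exact_mod_cast card_cols_partL_le e) hlt.2)

/-- **TZ Theorem 9, cocycle half (by Poincaré duality):** a vector of `ker H_Z ∖ rowsp H_X` — a cycle of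
the dual hypergraph `ℋ₁ᵀ·ℋ₂ᵀ` that is not one of its sums of chambers — has at least `min(d₁ᵀ, d₂ᵀ)` edges.
[cite: TillichZemor2014, Thm 9 and its proof (arXiv v1 chunk p0008 L46-50)] -/
theorem min_le_hammingNorm_of_cocycle (H₁ : Matrix V₁ E₁ (ZMod 2)) (H₂ : Matrix V₂ E₂ (ZMod 2))
    {e : (E₁ × V₂) ⊕ (V₁ × E₂) → ZMod 2} (he : e ∈ pcCode (zMatrix H₁ H₂))
    (hne : e ∉ rowSpace (xMatrix H₁ H₂)) :
    min (Coding.minDist (pcCode H₁ᵀ)) (Coding.minDist (pcCode H₂ᵀ)) ≤ (hammingNorm e : ℕ∞) := by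
  rw [zMatrix_eq_submatrix_swap,
    show (Sum.swap : (E₁ × V₂) ⊕ (V₁ × E₂) → (V₁ × E₂) ⊕ (E₁ × V₂)) = swapEquiv V₁ E₁ V₂ E₂ from rfl,
    mem_pcCode_submatrix_iff] at he
  rw [xMatrix_eq_submatrix_swap,
    show (Sum.swap : (E₁ × V₂) ⊕ (V₁ × E₂) → (V₁ × E₂) ⊕ (E₁ × V₂)) = swapEquiv V₁ E₁ V₂ E₂ from rfl,
    mem_rowSpace_submatrix_iff] at hne
  have h := min_le_hammingNorm_of_cycle H₁ᵀ H₂ᵀ he hne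
  rwa [hammingNorm_comp_equiv] at h

/-- **Tillich–Zémor Theorem 9, proved**: discharges the named fact `HypergraphProduct.minDist_ge` —
`D ≥ min(d₁, d₂, d₁ᵀ, d₂ᵀ)` for the quantum code of every product hypergraph `ℋ₁·ℋ₂`.
[cite: TillichZemor2014, Thm 9 (arXiv v1 chunk p0008 L11-15)] -/
theorem minDist_ge_holds : minDist_ge := by
  intro V₁ E₁ V₂ E₂ _ _ _ _ _ _ _ _ H₁ H₂
  refine le_cssMinDist_iff.2 fun e he => ?_
  rcases he with ⟨hX, hZ⟩ | ⟨hZ, hX⟩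
  · exact (min_le_left _ _).trans (min_le_hammingNorm_of_cycle H₁ H₂ hX hZ)
  · exact (min_le_right _ _).trans (min_le_hammingNorm_of_cocycle H₁ H₂ hZ hX)

end HypergraphProduct

end Literature.InformationTheory.QuantumCodes
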